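import Mathlib
import HarnessLib
import Literature.Analysis.FluidPDE.ExtremeGrowthBlowupRate
import Literature.Analysis.FluidPDE.ExtremeGrowthBoundsProofs
import Literature.Analysis.FluidPDE.MillerMiddleEigenvalueTorus
import Literature.Analysis.FluidPDE.TorusNSEnstrophyContinuation

/-!
# nsreg-p1 ROUND-15 (planned door S16 «plane-strain window door»), rung (ii): the TYPE-FREE explicit-constant rung
# on the torus — `λ₂⁺(t,x) ≤ ε/(T−t)` with `ε < 1/4` forbids blow-up at `T`

DIRECTOR-NS g6 #13 (b) («the type-free rung is a corollary of tree theorems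
`torusEnstrophy_le_mul_exp_integral_middleEigenvalueBound` + `inv_sqrt_le_torusEnstrophy` — land it, corollary-level»).
For a classical zero-mean solution of the unit-viscosity… (any `ν > 0`) Navier–Stokes system on `𝕋³ × [0,T)` whose
MIDDLE principal strain satisfies the scale-critical one-sided bound `λ₂(∇u(t,x)) ≤ ε/(T − t)` for all `(t,x)` with
`0 ≤ ε < 1/4`:

* `torusEnstrophy_le_of_middleEigenvalue_le_typeI` — the enstrophy grows at most like `ℰ(u(t)) ≤ ℰ(u(0)) (T/(T−t))^{2ε}`
  (Miller / Neustupa–Penel Grönwall `torusEnstrophy_le_mul_exp_integral_middleEigenvalueBound` with the continuous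
  majorant `Λ(s) = ε/(T−s)` on `[0,t]`, `∫₀ᵗ Λ = ε log (T/(T−t))`);
* `bddAbove_torusEnstrophy_of_middleEigenvalue_le_typeI` — hence the enstrophy stays BOUNDED on `[0,T)`: were it
  unbounded, Leray's necessary rate `ℰ(u(t)) ≥ (2 C_LD (T−t))^{−1/2}` (`inv_sqrt_le_torusEnstrophy` over the discharged
  `LuDoering2008_enstrophyRate_le_holds`) would contradict the growth bound since `2ε < 1/2`;
* `Torus.classicalNS_continuation_of_middleEigenvalue_le_typeI` — so the solution extends classically past `T`
  (`Torus.classicalNS_continuation_of_gradNormSq_le`).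

The threshold `1/4` is the torus tree constant (`∂ₜℰ ≤ 2 λ₂⁺ ℰ`); it is NOT in the `L¹_t`-family of Neustupa–Penel 2003 /
Miller 2020 (`∫₀ᵀ ε/(T−t) dt = ∞`).  Seat nsreg-p6 g7 (anchor `--supports stmt-NavierStokesRegularity-11719` per the director).
WHAT THIS IS NOT: not NS regularity (a conditional, explicit-constant continuation criterion on 𝕋³); not the ℝ³ rung
(whose bricks are `MillerMiddleEigenvalueSupGronwall` + `NSLerayBlowupRateEnstrophy` + the Miller patch plumbing).
-/

noncomputable section

open MeasureTheory Set Function Filter Topology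
open scoped InnerProductSpace RealInnerProductSpace
open Literature.Analysis Literature.Analysis.FluidPDE Literature.Analysis.FunctionSpaces

-- the summit and its single sub-problem share the name (CONVENTIONS §1), as in every Theorems file
set_option linter.dupNamespace false

namespace Summit.NavierStokesRegularity.NavierStokesRegularity.Theorems.PlaneStrainDoorTypeFreeRungTorus

variable {d : Type*} [Fintype d] [DecidableEq d]

/-- `∫₀ᵗ ε/(T−s) ds = ε log (T/(T−t))` for `t < T` (`T > 0`). -/
theorem integral_eps_div_sub (T ε t : ℝ) (hT : 0 < T) (ht : t < T) :
    ∫ s in (0 : ℝ)..t, ε / (T - s) = ε * Real.log (T / (T - t)) := by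
  have h1 : ∫ s in (0 : ℝ)..t, ε / (T - s) = ε * ∫ s in (0 : ℝ)..t, (T - s)⁻¹ := by
    rw [← intervalIntegral.integral_const_mul]
    refine intervalIntegral.integral_congr fun s _ => ?_
    simp [div_eq_mul_inv]
  rw [h1, intervalIntegral.integral_comp_sub_left (fun x => x⁻¹) T, sub_zero,
    integral_inv_of_pos (by linarith) hT]

/-- **Growth bound**: `λ₂ ≤ ε/(T−t)` on `[0,T)` ⇒ `ℰ(u(t)) ≤ ℰ(u(0)) · (T/(T−t))^{2ε}` for `t ∈ [0,T)`. -/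
theorem torusEnstrophy_le_of_middleEigenvalue_le_typeI (hd : Fintype.card d = 3) {ν T ε : ℝ} (hν : 0 < ν)
    (hT : 0 < T) (hε0 : 0 ≤ ε) {u : ℝ → UnitAddTorus d → EuclideanSpace ℝ d} {p : ℝ → UnitAddTorus d → ℝ}
    (h : Torus.IsClassicalNSSolutionOn (Ico 0 T) ν 0 u p)
    (hΛ : ∀ s ∈ Ico 0 T, ∀ x, ∀ hx : (Matrix.of fun i j =>
        (Torus.partialDeriv j (u s) x i + Torus.partialDeriv i (u s) x j) / 2).IsHermitian,
        hx.eigenvalues₀ (Fin.cast hd.symm 1) ≤ ε / (T - s))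
    {t : ℝ} (ht : t ∈ Ico 0 T) :
    torusEnstrophy (u t) ≤ torusEnstrophy (u 0) * (T / (T - t)) ^ (2 * ε) := by
  rcases ht.1.eq_or_lt with h0 | h0t
  · rw [← h0, sub_zero, div_self hT.ne', Real.one_rpow, mul_one]
  have hsub : Icc 0 t ⊆ Ico 0 T := fun s hs => ⟨hs.1, hs.2.trans_lt ht.2⟩
  have ht' : Torus.IsClassicalNSSolutionOn (Icc 0 t) ν 0 u p := h.mono hsub (uniqueDiffOn_Icc h0t)
  have hΛc : ContinuousOn (fun s => ε / (T - s)) (Icc 0 t) := by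
    refine continuousOn_const.div (continuousOn_const.sub continuousOn_id) fun s hs => ?_
    have : s < T := hs.2.trans_lt ht.2
    linarith
  have hΛ0 : ∀ s ∈ Icc 0 t, 0 ≤ ε / (T - s) := fun s hs =>
    div_nonneg hε0 (by linarith [hs.2.trans_lt ht.2])
  have hmain := torusEnstrophy_le_mul_exp_integral_middleEigenvalueBound hd hν.le h0t ht' hΛc hΛ0
    (fun s hs x hx => hΛ s (hsub hs) x hx) ⟨h0t.le, le_rfl⟩
  rw [integral_eps_div_sub T ε t hT ht.2] at hmain
  have hTt : 0 < T / (T - t) := div_pos hT (sub_pos.2 ht.2)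
  have hexp : Real.exp (2 * (ε * Real.log (T / (T - t)))) = (T / (T - t)) ^ (2 * ε) := by
    rw [Real.rpow_def_of_pos hTt]; congr 1; ring
  rwa [hexp] at hmain

/-- **Boundedness of the enstrophy**: `λ₂ ≤ ε/(T−t)` on `[0,T)` with `ε < 1/4` ⇒ `ℰ(u(·))` is bounded on `[0,T)`
(zero-mean classical solution on `𝕋³`). -/
theorem bddAbove_torusEnstrophy_of_middleEigenvalue_le_typeI (hd : Fintype.card d = 3) {ν T ε : ℝ} (hν : 0 < ν)
    (hT : 0 < T) (hε0 : 0 ≤ ε) (hε : ε < 1 / 4) {u : ℝ → UnitAddTorus d → EuclideanSpace ℝ d}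
    {p : ℝ → UnitAddTorus d → ℝ} (h : Torus.IsClassicalNSSolutionOn (Ico 0 T) ν 0 u p)
    (hmean : ∀ t ∈ Ico 0 T, Torus.HasZeroMean (u t))
    (hΛ : ∀ s ∈ Ico 0 T, ∀ x, ∀ hx : (Matrix.of fun i j =>
        (Torus.partialDeriv j (u s) x i + Torus.partialDeriv i (u s) x j) / 2).IsHermitian,
        hx.eigenvalues₀ (Fin.cast hd.symm 1) ≤ ε / (T - s)) :
    BddAbove ((fun t => torusEnstrophy (u t)) '' Ico 0 T) := by
  have hgrow : ∀ t ∈ Ico 0 T, torusEnstrophy (u t) ≤ torusEnstrophy (u 0) * (T / (T - t)) ^ (2 * ε) :=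
    fun t ht => torusEnstrophy_le_of_middleEigenvalue_le_typeI hd hν hT hε0 h hΛ ht
  set E₀ : ℝ := torusEnstrophy (u 0) with hE₀
  have hE₀0 : 0 ≤ E₀ := torusEnstrophy_nonneg _
  by_contra hunb
  -- positivity of the enstrophy at every time (else it would vanish from some time on and be bounded)
  have hpos : ∀ t ∈ Ico 0 T, 0 < torusEnstrophy (u t) := by
    intro t₁ ht₁
    by_contra hle
    have hz : torusEnstrophy (u t₁) = 0 := le_antisymm (not_lt.1 hle) (torusEnstrophy_nonneg _)
    apply hunb
    refine ⟨E₀ * (T / (T - t₁)) ^ (2 * ε), ?_⟩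
    rintro _ ⟨t, ht, rfl⟩
    rcases le_or_gt t t₁ with htt | htt
    · -- before `t₁`: the growth bound, monotone in `t`
      refine (hgrow t ht).trans (mul_le_mul_of_nonneg_left ?_ hE₀0)
      refine Real.rpow_le_rpow (div_pos hT (sub_pos.2 ht.2)).le ?_ (by linarith)
      exact div_le_div_of_nonneg_left hT.le (sub_pos.2 ht₁.2) (by linarith)
    · -- after `t₁`: Grönwall from `t₁` with zero initial enstrophy
      have hsub : Icc t₁ t ⊆ Ico 0 T := fun s hs => ⟨ht₁.1.trans hs.1, hs.2.trans_lt ht.2⟩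
      have ht' : Torus.IsClassicalNSSolutionOn (Icc t₁ t) ν 0 u p := h.mono hsub (uniqueDiffOn_Icc htt)
      have hΛc : ContinuousOn (fun s => ε / (T - s)) (Icc t₁ t) := by
        refine continuousOn_const.div (continuousOn_const.sub continuousOn_id) fun s hs => ?_
        have : s < T := hs.2.trans_lt ht.2
        linarith
      have hΛ0 : ∀ s ∈ Icc t₁ t, 0 ≤ ε / (T - s) := fun s hs =>
        div_nonneg hε0 (by linarith [hs.2.trans_lt ht.2])
      have hm := torusEnstrophy_le_mul_exp_integral_middleEigenvalueBound hd hν.le htt ht' hΛc hΛ0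
        (fun s hs x hx => hΛ s (hsub hs) x hx) ⟨htt.le, le_rfl⟩
      rw [hz, zero_mul] at hm
      exact hm.trans (mul_nonneg hE₀0 (Real.rpow_nonneg (div_pos hT (sub_pos.2 ht₁.2)).le _))
  -- Leray's necessary rate vs the growth bound, at a time close to `T`
  set C : ℝ := luDoeringConst ν with hC
  have hC0 : 0 < C := luDoeringConst_pos hν
  set γ : ℝ := 1 / 2 - 2 * ε with hγ
  have hγ0 : 0 < γ := by rw [hγ]; linarith
  set M : ℝ := E₀ * T ^ (2 * ε) * Real.sqrt (2 * C) with hM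
  have hM0 : 0 ≤ M := by positivity
  -- `δ` with `M δ^γ < 1` and `δ ≤ T/2`
  set δ₀ : ℝ := (1 / (2 * (M + 1))) ^ (1 / γ) with hδ₀
  have hδ₀pos : 0 < δ₀ := Real.rpow_pos_of_pos (by positivity) _
  have hδ₀γ : δ₀ ^ γ = 1 / (2 * (M + 1)) := by
    rw [hδ₀, ← Real.rpow_mul (by positivity), one_div_mul_cancel hγ0.ne', Real.rpow_one]
  set δ : ℝ := min δ₀ (T / 2) with hδ
  have hδpos : 0 < δ := lt_min hδ₀pos (half_pos hT)
  have hδT : δ < T := (min_le_right _ _).trans_lt (half_lt_self hT)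
  have hδγ : δ ^ γ ≤ 1 / (2 * (M + 1)) := by
    rw [← hδ₀γ]; exact Real.rpow_le_rpow hδpos.le (min_le_left _ _) hγ0.le
  have hMδ : M * δ ^ γ < 1 := by
    calc M * δ ^ γ ≤ M * (1 / (2 * (M + 1))) := mul_le_mul_of_nonneg_left hδγ hM0
      _ < 1 := by rw [mul_one_div, div_lt_one (by positivity)]; linarith
  -- the time `t = T - δ`
  set t : ℝ := T - δ with htdef
  have ht : t ∈ Ico 0 T := ⟨by rw [htdef]; linarith, by rw [htdef]; linarith⟩
  have hTt : T - t = δ := by rw [htdef]; ring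
  have hlow := inv_sqrt_le_torusEnstrophy LuDoering2008_enstrophyRate_le_holds hd hν h hmean hpos hunb ht
  have hup := hgrow t ht
  rw [hTt] at hlow hup
  -- `1/√(2Cδ) ≤ E₀ (T/δ)^{2ε}` ⇒ `1 ≤ M δ^γ`
  have hsq : 0 < Real.sqrt (2 * C * δ) := Real.sqrt_pos.2 (by positivity)
  have hchain : 1 / Real.sqrt (2 * C * δ) ≤ E₀ * (T / δ) ^ (2 * ε) := hlow.trans hup
  have h1 : 1 ≤ E₀ * (T / δ) ^ (2 * ε) * Real.sqrt (2 * C * δ) := by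
    rw [div_le_iff₀ hsq] at hchain; linarith
  have hid : E₀ * (T / δ) ^ (2 * ε) * Real.sqrt (2 * C * δ) = M * δ ^ γ := by
    rw [hM, hγ, Real.div_rpow hT.le hδpos.le, Real.sqrt_eq_rpow, Real.sqrt_eq_rpow,
      Real.mul_rpow (by positivity) hδpos.le]
    have e1 : δ ^ (1 / 2 - 2 * ε) = δ ^ (1 / 2 : ℝ) / δ ^ (2 * ε) := by
      rw [Real.rpow_sub hδpos]
    rw [e1]
    field_simp
  rw [hid] at h1
  linarith

/-- **The type-free rung on the torus**: a classical zero-mean solution on `𝕋³ × [0,T)` with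
`λ₂(∇u(t,x)) ≤ ε/(T−t)`, `0 ≤ ε < 1/4`, extends to a classical zero-mean solution on a closed slab `[0,T']`, `T' > T`. -/
theorem classicalNS_continuation_of_middleEigenvalue_le_typeI (hd : Fintype.card d = 3) {ν T ε : ℝ} (hν : 0 < ν)
    (hT : 0 < T) (hε0 : 0 ≤ ε) (hε : ε < 1 / 4) {u : ℝ → UnitAddTorus d → EuclideanSpace ℝ d}
    {p : ℝ → UnitAddTorus d → ℝ} (h : Torus.IsClassicalNSSolutionOn (Ico 0 T) ν 0 u p)
    (hmean : ∀ t ∈ Ico 0 T, Torus.HasZeroMean (u t))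
    (hΛ : ∀ s ∈ Ico 0 T, ∀ x, ∀ hx : (Matrix.of fun i j =>
        (Torus.partialDeriv j (u s) x i + Torus.partialDeriv i (u s) x j) / 2).IsHermitian,
        hx.eigenvalues₀ (Fin.cast hd.symm 1) ≤ ε / (T - s)) :
    ∃ T' : ℝ, T < T' ∧ ∃ (u' : ℝ → UnitAddTorus d → EuclideanSpace ℝ d) (p' : ℝ → UnitAddTorus d → ℝ),
      Torus.IsClassicalNSSolutionOn (Icc 0 T') ν 0 u' p' ∧ (∀ t ∈ Icc 0 T', Torus.HasZeroMean (u' t)) ∧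
        ∀ t ∈ Ico 0 T, u' t = u t := by
  obtain ⟨B, hB⟩ := bddAbove_torusEnstrophy_of_middleEigenvalue_le_typeI hd hν hT hε0 hε h hmean hΛ
  refine Torus.classicalNS_continuation_of_gradNormSq_le hd hν hT h hmean (E₁ := 2 * B) fun t ht => ?_
  have hb : torusEnstrophy (u t) ≤ B := hB ⟨t, ht, rfl⟩
  rw [gradNormSq_eq_two_mul_torusEnstrophy]
  linarith

end Summit.NavierStokesRegularity.NavierStokesRegularity.Theorems.PlaneStrainDoorTypeFreeRungTorus

end
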